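import Summits.CriticalPhenomena.PercolationContinuityZ3.Theorems.SahiConjectureProduct
import Literature.Combinatorics.Sahi2008.FKGCumulation

/-!
# Cumulation padding is free: what `SahiConjecture K` / `KahnConjecture` give at EVERY order `n`

Companion of `SahiConjecture.lean` / `SahiConjectureProduct.lean` (cell `prim-sahi`, typer;
`--supports stmt-CriticalPhenomena-4575`).  One-line Summits corollaries requested by the cell
`prim-cplus-literature` (memo CUMULATION-PADDING, gen 26, §3) of the RELATIVE BLINOVSKY THEOREM now in
the tree (`Literature/Combinatorics/Sahi2008/FKGCumulation.lean`,
`Literature.Combinatorics.Sahi2008.sahiE_nonneg_offK_of_condClosed` and its instances): on a class of FKG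
probability weights closed under conditioning on principal up-sets of positive mass, order-`K` Sahi
positivity already yields `E_n ≥ 0` for EVERY `n` on all nonnegative monotone families of which all but
at most `K` slots are CUMULATIONS (Sahi's class `𝒞`: nonnegative combinations of indicators of principal
up-sets `{x | c ≤ x}`; on `2^ι`: of cylinder events `{ω | S ⊆ ω}`).

Read through the typed obligations of this directory:

* `sahiE_nonneg_offK_of_sahiConjecture` — `SahiConjecture K` ⇒ for every finite distributive lattice,
  every FKG probability weight, every `n` and every nonnegative monotone family with `≤ K` non-cumulation
  slots, `0 ≤ E_n` (all FKG weights of a lattice are closed under principal conditioning by Blinovsky's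
  Lemma, `IsFKGMeasure.cond_principalUp`);  and the EQUIVALENCE `sahiConjecture_iff_forall_offK`:
  the padded hierarchy `{C_n restricted to ≤ K free slots, all n}` IS `C_K`;
* `sahiE_bernoulliWeight_nonneg_offThree_of_kahnConjecture` (function form) and the event forms
  `sahiE_ind_nonneg_offThree_of_kahnConjecture` (three arbitrary INCREASING events padded by cylinder
  events `{ω | S_j ⊆ ω}` — percolation: "all edges of `S_j` open") /
  `sahiE_ind_nonneg_offThree_of_kahnConjecture_lower` (three arbitrary DECREASING events padded by
  closed cylinders `{ω | ω ⊆ C_j}` — percolation: "all edges outside `C_j` closed", e.g. three group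
  separations `D[X_i|Y_i]` padded by edge-closure events): Kahn's Conjecture 5 (`n = 3`, product
  measures) ALONE gives all these padded rows at every order `n`, on every finite product space;
* the general-`K` product forms from `SahiConjecture K` (`…_offK_of_sahiConjecture{,_lower}`).

So (memo §3): every genuinely new obligation at level `n` of the hierarchy concerns families with `n`
NON-principal slots; padding by cylinder / principal slots never creates a new obligation.  Unconditional
`K = 2` versions (Harris/FKG base) are the Literature theorems
`sahiE_nonneg_of_isLatticeCumulation_offTwo`, `sahiE_bernoulliWeight_ind_nonneg_offTwo{,_lower}`,
`sahiE4_prodBernoulli_nonneg_of_cylinders / _of_subsetCylinders` (not restated here).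

Nothing in this file asserts `SahiConjecture K` or `KahnConjecture` (both `[status: open]`); every
declaration takes them as hypotheses.
-/

noncomputable section

namespace Summit.CriticalPhenomena.PercolationContinuityZ3.Theorems

open Literature.Combinatorics.Sahi2008
open Literature.Probability.Percolation.DecisionTree (ind)

/-! ### FKG weights of a finite distributive lattice -/

/-- **`C_K` ⇒ the padded `C_n`, every `n`, every FKG poset.**  Assuming `SahiConjecture K`: for every
finite distributive lattice `α`, every FKG probability weight `μ` on `α`, every `n`, and nonnegative
monotone `f_0,…,f_{n-1}` such that `f_i` is a cumulation for every `i ∉ I`, `|I| ≤ K`: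
`0 ≤ E_n(f_0,…,f_{n-1})`.  (Relative Blinovsky theorem `sahiE_nonneg_of_isLatticeCumulation_offK`
applied to the class of all FKG weights of `α`.) [cite: Blinovsky2013, eq. (ee3); Sahi2008, Thm. 2
(p. 211); LiebSahi2021, p. 3 (hierarchy)] -/
theorem sahiE_nonneg_offK_of_sahiConjecture {K : ℕ} (hC : SahiConjecture K) {α : Type}
    [DistribLattice α] [Fintype α] [DecidableEq α] [DecidableLE α] {μ : α → ℝ} (hμ : IsFKGMeasure μ)
    {n : ℕ} (f : Fin n → α → ℝ) (hf0 : ∀ i x, 0 ≤ f i x) (hfm : ∀ i, Monotone (f i))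
    (I : Finset (Fin n)) (hI : I.card ≤ K) (hcum : ∀ i, i ∉ I → IsLatticeCumulation (f i)) :
    0 ≤ sahiE μ n f :=
  sahiE_nonneg_of_isLatticeCumulation_offK K (fun ν hν => hC α ν hν) hμ f hf0 hfm I hI hcum

/-- **The padded hierarchy collapses onto `C_K`:** `SahiConjecture K` is EQUIVALENT to "`E_n ≥ 0` for every
finite distributive lattice, every FKG probability weight, every `n` and every nonnegative monotone family
with at most `K` non-cumulation slots" (`←`: take `n = K`, all slots free).  Head `↔` between an obligation
and its padded form; neither side is asserted. [cite: LiebSahi2021, p. 3 (hierarchy); Blinovsky2013,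
eq. (ee3); Sahi2008, Thm. 2 (p. 211)] -/
theorem sahiConjecture_iff_forall_offK (K : ℕ) :
    SahiConjecture K ↔
      ∀ (α : Type) [DistribLattice α] [Fintype α] [DecidableEq α] [DecidableLE α] (μ : α → ℝ),
        IsFKGMeasure μ → ∀ (n : ℕ) (f : Fin n → α → ℝ), (∀ i x, 0 ≤ f i x) → (∀ i, Monotone (f i)) →
          ∀ I : Finset (Fin n), I.card ≤ K → (∀ i, i ∉ I → IsLatticeCumulation (f i)) →
            0 ≤ sahiE μ n f := by
  classical
  refine ⟨fun hC α _ _ _ _ μ hμ n f hf0 hfm I hI hcum =>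
    sahiE_nonneg_offK_of_sahiConjecture hC hμ f hf0 hfm I hI hcum, fun h α _ _ μ hμ f hf0 hfm => ?_⟩
  exact h α μ hμ K f hf0 hfm Finset.univ (by simp) (fun i hi => absurd (Finset.mem_univ i) hi)

/-! ### Product measures on finite cubes `Set ι` -/

section Product

variable {ι : Type} [Fintype ι]

/-- **`C_K` ⇒ padded `C_n` for product weights, function form.**  Assuming `SahiConjecture K`: for every
product weight `bernoulliWeight p` on `Set ι`, every `n`, nonnegative monotone `f_i` that are cumulations
off a set `I` of at most `K` slots, `0 ≤ E_n(f)`. [cite: Sahi2008, Thm. 2 (p. 211), eq. (2) (p. 210);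
Blinovsky2013, eq. (ee3); Kahn2022, Conj. 5 (arXiv p. 3)] -/
theorem sahiE_bernoulliWeight_nonneg_offK_of_sahiConjecture [DecidableEq (Set ι)] [DecidableLE (Set ι)]
    {K : ℕ} (hC : SahiConjecture K) (p : ι → unitInterval) {n : ℕ} (f : Fin n → Set ι → ℝ) (hf0 : ∀ i x, 0 ≤ f i x)
    (hfm : ∀ i, Monotone (f i)) (I : Finset (Fin n)) (hI : I.card ≤ K)
    (hcum : ∀ i, i ∉ I → IsLatticeCumulation (f i)) : 0 ≤ sahiE (bernoulliWeight p) n f :=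
  sahiE_bernoulliWeight_nonneg_offK K
    (fun q => (sahiConjecture_iff_forall_bernoulliWeight K).1 hC ι q) p f hf0 hfm I hI hcum

/-- **`C_K` ⇒ padded rows, increasing events.**  Assuming `SahiConjecture K`: for events `A_0,…,A_{n-1}` of a
finite product space such that `A_i` is increasing for `i ∈ I` (`|I| ≤ K`) and a cylinder `{ω | S_i ⊆ ω}`
otherwise, `0 ≤ E_n(1_{A_0},…,1_{A_{n-1}})` under every product weight. [cite: Sahi2008, Thm. 2 (p. 211);
Kahn2022, Conj. 5 (arXiv p. 3); LiebSahi2021, p. 3] -/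
theorem sahiE_ind_nonneg_offK_of_sahiConjecture {K : ℕ} (hC : SahiConjecture K) (p : ι → unitInterval)
    {n : ℕ} (A : Fin n → Set (Set ι)) (I : Finset (Fin n)) (hI : I.card ≤ K)
    (hA : ∀ i, i ∈ I → IsUpperSet (A i)) (S : Fin n → Set ι) (hS : ∀ i, i ∉ I → A i = {ω | S i ⊆ ω}) :
    0 ≤ sahiE (bernoulliWeight p) n (fun i => ind (A i)) :=
  sahiE_bernoulliWeight_ind_nonneg_offK K (fun q => (sahiConjecture_iff_forall_bernoulliWeight K).1 hC ι q)
    p A I hI hA S hS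

/-- **`C_K` ⇒ padded rows, decreasing events.**  Assuming `SahiConjecture K` (applied to the order duals
`(Set ι)ᵒᵈ`, which are FKG posets under the dual product weight): for events `A_0,…,A_{n-1}` such that `A_i`
is DEcreasing for `i ∈ I` (`|I| ≤ K`) and a closed cylinder `{ω | ω ⊆ C_i}` otherwise,
`0 ≤ E_n(1_{A_0},…,1_{A_{n-1}})` under every product weight. [cite: Sahi2008, Thm. 2 (p. 211); LiebSahi2021,
p. 3 and footnote 2; Kahn2022, Conj. 5 (arXiv p. 3)] -/
theorem sahiE_ind_nonneg_offK_of_sahiConjecture_lower {K : ℕ} (hC : SahiConjecture K)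
    (p : ι → unitInterval) {n : ℕ} (A : Fin n → Set (Set ι)) (I : Finset (Fin n)) (hI : I.card ≤ K)
    (hA : ∀ i, i ∈ I → IsLowerSet (A i)) (C : Fin n → Set ι) (hS : ∀ i, i ∉ I → A i = {ω | ω ⊆ C i}) :
    0 ≤ sahiE (bernoulliWeight p) n (fun i => ind (A i)) :=
  sahiE_bernoulliWeight_ind_nonneg_offK_lower K
    (fun q => hC (Set ι)ᵒᵈ (bernoulliWeightDual q) (isFKGMeasure_bernoulliWeightDual q)) p A I hI hA C hS

/-! ### Kahn's Conjecture 5 alone (`K = 3`, product measures) -/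

/-- **Kahn ⇒ padded `C_n` for product weights, function form (`K = 3`).**  Assuming `KahnConjecture`
(three increasing events, product measures): for every product weight on a finite cube, every `n`, and
nonnegative monotone `f_i` that are cumulations off at most three slots, `0 ≤ E_n(f)` — via the layer cake
`kahnConjecture_iff_sahiPositive`. [cite: Kahn2022, Conj. 5 (arXiv p. 3); Sahi2008, Thm. 2 (p. 211);
Blinovsky2013, eq. (ee3)] -/
theorem sahiE_bernoulliWeight_nonneg_offThree_of_kahnConjecture [DecidableEq (Set ι)]
    [DecidableLE (Set ι)] (hK : KahnConjecture) (p : ι → unitInterval) {n : ℕ} (f : Fin n → Set ι → ℝ) (hf0 : ∀ i x, 0 ≤ f i x)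
    (hfm : ∀ i, Monotone (f i)) (I : Finset (Fin n)) (hI : I.card ≤ 3)
    (hcum : ∀ i, i ∉ I → IsLatticeCumulation (f i)) : 0 ≤ sahiE (bernoulliWeight p) n f :=
  sahiE_bernoulliWeight_nonneg_offK 3 (fun q => kahnConjecture_iff_sahiPositive.1 hK ι q) p f hf0
    hfm I hI hcum

/-- **Kahn ⇒ every padded INCREASING row, every order.**  Assuming `KahnConjecture`: for events
`A_0,…,A_{n-1}` of a finite product space with `A_i` increasing for `i ∈ I`, `|I| ≤ 3`, and cylinders
`{ω | S_i ⊆ ω}` ("all coordinates of `S_i` are `1`") otherwise, `0 ≤ E_n(1_{A_0},…,1_{A_{n-1}})` under every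
product weight (memo §3: "(M-3) ⇒ all padded orders with three free increasing events").
[cite: Kahn2022, Conj. 5 (arXiv p. 3); Sahi2008, Thm. 2 (p. 211); LiebSahi2021, p. 3] -/
theorem sahiE_ind_nonneg_offThree_of_kahnConjecture (hK : KahnConjecture) (p : ι → unitInterval)
    {n : ℕ} (A : Fin n → Set (Set ι)) (I : Finset (Fin n)) (hI : I.card ≤ 3)
    (hA : ∀ i, i ∈ I → IsUpperSet (A i)) (S : Fin n → Set ι) (hS : ∀ i, i ∉ I → A i = {ω | S i ⊆ ω}) :
    0 ≤ sahiE (bernoulliWeight p) n (fun i => ind (A i)) :=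
  sahiE_bernoulliWeight_ind_nonneg_offK 3 (fun q => kahnConjecture_iff_sahiPositive.1 hK ι q) p A I hI hA
    S hS

/-- **Kahn ⇒ every padded DECREASING row, every order.**  Assuming `KahnConjecture` (⟺ `SahiConjecture 3`,
`sahiConjecture_three_iff_kahnConjecture`, then applied to the dual lattices `(Set ι)ᵒᵈ`): for events
`A_0,…,A_{n-1}` with `A_i` DEcreasing for `i ∈ I`, `|I| ≤ 3` (e.g. three group separations `D[X_i|Y_i]` of
bond percolation on a finite graph) and closed cylinders `{ω | ω ⊆ C_i}` ("all coordinates outside `C_i` are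
`0`") otherwise, `0 ≤ E_n(1_{A_0},…,1_{A_{n-1}})` under every product weight.
[cite: Kahn2022, Conj. 5 (arXiv p. 3); LiebSahi2021, p. 3 and footnote 2; Sahi2008, Thm. 2 (p. 211)] -/
theorem sahiE_ind_nonneg_offThree_of_kahnConjecture_lower (hK : KahnConjecture) (p : ι → unitInterval)
    {n : ℕ} (A : Fin n → Set (Set ι)) (I : Finset (Fin n)) (hI : I.card ≤ 3)
    (hA : ∀ i, i ∈ I → IsLowerSet (A i)) (C : Fin n → Set ι) (hS : ∀ i, i ∉ I → A i = {ω | ω ⊆ C i}) :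
    0 ≤ sahiE (bernoulliWeight p) n (fun i => ind (A i)) :=
  sahiE_ind_nonneg_offK_of_sahiConjecture_lower (sahiConjecture_three_iff_kahnConjecture.2 hK) p A I hI hA
    C hS

end Product

end Summit.CriticalPhenomena.PercolationContinuityZ3.Theorems
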